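import Literature.NumberTheory.EllipticCurves.VeluNormProofs
import Mathlib.FieldTheory.IsAlgClosed.AlgebraicClosure
import HarnessLib

/-!
# The discriminant of Vélu's quotient: `Δ(E/G) · Π_{v ∈ G ∖ O} (2y(v))⁴ = Δ(E)^{#G}`
# (the algebraic core of Dokchitser–Dokchitser 2015, Thm. 3 = Coates' `Δ^p/Δ'` lemma; proofs only)

Trunk T-NT-EC (`Literature/NumberTheory/EllipticCurves`); a `Proofs` file (THEOREMS ONLY: no
definition, no named fact, no instance), sequel of `VeluOddKernelProofs.lean` and
`VeluNormProofs.lean`. Setting of those files: `E : y² = f(x) = x³ + a₄x + a₆` a short Weierstrass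
elliptic curve over a field of characteristic `0`, `G ⊆ E(F)` a finite subgroup without points of
order `2` (`IsOddSubgroupFinset G`, `#G = n` odd), `E' = E/G : y² = x³ + a'x + b'` Vélu's quotient
(`a' = veluA G`, `b' = veluB G`), the isogeny being normalised (`ψ^*(dx'/2y') = dx/2y`,
`VeluNormProofs`: `veluS_eq_derivative`).

## Main results

* `sub_mul_xOf_twoTorsion_add` — the `2`-torsion translation on `y² = (x - r₁)(x - r₂)(x - r₃)`:
  `(x(v) - r₁)·(x((r₁, 0) + v) - r₂) = (r₁ - r₂)·(x(v) - r₃)`;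
* `prod_erase_zero_xOf_sub` — `Π_{v ∈ G ∖ O} (x(v) - c) = D(c)²` (`D` the kernel polynomial);
* `veluRho_sub_veluRho` — **the `2`-torsion points of `E'`**: for the roots `ρᵢ = x'(ψ(rᵢ, 0))` of
  the Vélu cubic, `D(r₁)²·D(r₂)²·(ρ₁ - ρ₂) = (r₁ - r₂)^{#G}·D(r₃)²`;
* `prod_erase_zero_yOf_sq` — `Π_{v ∈ G ∖ O} y(v)² = D(r₁)²D(r₂)²D(r₃)²`;
* **`veluDisc_mul_prod_yOf_pow_four`** — `(4a'³ + 27b'²)·Π_{v ∈ G ∖ O} y(v)⁴ = (4a₄³ + 27a₆²)^{#G}`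
  over ANY field of characteristic `0` (no splitting hypothesis: the roots `rᵢ` are adjoined in an
  algebraic closure and the identity descends), and its discriminant form
  **`veluDelta_mul_prod_pow_four`**: `Δ(E')·Π_{v ∈ G ∖ O}(2y(v))⁴ = Δ(E)^{#G}` with
  `E' = ⟨0, 0, 0, a', b'⟩`.

## Why (the printed result this serves)

T. Dokchitser, V. Dokchitser, *Local invariants of isogenous elliptic curves*, Trans. AMS 367
(2015), §2, Thm. 3 (= J. Coates, Bull. LMS 23 (1991), appendix, Thm. 8): for a `p`-isogeny
`φ : E → E'` over a field of characteristic `0`, `p > 3`, `Δ(E)^p/Δ(E')` is a `12`-th power — proved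
in print through the `η`-quotient `(η(pτ)^p/η(τ))²` and the `q`-expansion principle. The identity of
this file is the algebraic (Vélu) form of the discriminant relation behind it, valid for EVERY odd
kernel: `Δ(E)^{#G}/Δ(E/G) = (Π_{v ∈ G ∖ O} 2y(v))⁴` for the normalised quotient model, hence
`Δ(E)^{#G} ≡ Δ(E') · N⁴ (mod K^{×12})` for any model `E'` of `E/G` over `K`, with
`N = Π_{v ∈ G ∖ O} 2y(v) ∈ K` when `G` is `K`-rational. (That `N` is moreover a cube up to sign
when `gcd(#G, 6) = 1`, which gives Coates' `12`-th power, is NOT proved here.) Consumers: the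
discriminant rows of Dokchitser–Dokchitser's Table 1 (`δ' ≡ pδ mod 12`, their Thm. 6 / Cor. 8),
i.e. the tree's cite-only `dokchitser_padicValInt_minimalDiscriminantInt_eq_of_isogeny_of_potentiallyGoodOrdinary`
at primes `p ≡ 1 (mod 12)`.

## Proof

Over a field where `f = (X - r₁)(X - r₂)(X - r₃)` splits: the Vélu cubic is
`(X - ρ₁)(X - ρ₂)(X - ρ₃)` with `ρᵢ = U(rᵢ)/D(rᵢ)²` (`VeluNormProofs`: `veluCubic_eq_prod`, the
`2`-torsion trick), and the norm of `x - r₂` along `G` at the `2`-torsion point `(r₁, 0)` is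
`D(r₁)²·Π_{v ∈ G}(x((r₁,0) + v) - r₂) = V_{r₂}(r₁) = D(r₂)²·(U(r₁) - ρ₂D(r₁)²)` (`veluD_sq_mul_norm`,
`veluV_eq_of_isRoot`), whence `D(r₂)²(ρ₁ - ρ₂) = Π_{v ∈ G}(x((r₁,0)+v) - r₂)`. The `2`-torsion
translation evaluates the product: `(r₁ - r₂)·Π_{v ≠ O}(r₁ - r₂)(x(v) - r₃)/(x(v) - r₁) =
(r₁ - r₂)^{n}·D(r₃)²/D(r₁)²`. Multiplying the three differences and using
`Π_{v ≠ O} y(v)² = Π_{v ≠ O} Πᵢ (x(v) - rᵢ) = Πᵢ D(rᵢ)²` gives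
`Π_{i<j}(ρᵢ - ρⱼ)² · Π_{v ≠ O} y(v)⁴ = Π_{i<j}(rᵢ - rⱼ)^{2n}`, and `4a³ + 27b² = -Π_{i<j}(rᵢ - rⱼ)²`
for a depressed cubic (`n` odd). The general case follows by base change to an algebraic closure
(`veluA_image`, `veluB_image`, `yOf_map` of `VeluOddKernelProofs`).

## Sources

* T. Dokchitser, V. Dokchitser, Trans. Amer. Math. Soc. 367 (2015) 4339–4358, §2 Thm. 3 and
  Table 1. [DokchitserDokchitser2015LocalInvariants]
* J. Vélu, *Isogénies entre courbes elliptiques*, C. R. Acad. Sci. Paris 273 (1971) 238–241. [Velu1971]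
* D. Kohel, *Endomorphism rings of elliptic curves over finite fields*, thesis (1996), §2.4. [Kohel1996]
* J. H. Silverman, *The Arithmetic of Elliptic Curves*, 2nd ed. (2009), III.1 (discriminant of
  `y² = f(x)`), III.2.3 (group law). [SilvermanAEC2009]

## Design

Theorems only; hypotheses and notation verbatim those of `VeluNormProofs` (`W : WeierstrassCurve F`,
points of `W⁄F`, `hf : veluF (W⁄F) = (X - C r₁)(X - C r₂)(X - C r₃)`); the final statements over
an arbitrary field `K` of characteristic `0` with `G : Finset (W⁄K).toAffine.Point`.
-/

noncomputable section

open scoped Classical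

namespace WeierstrassCurve

open Polynomial Affine Affine.Point

/-! ### The `2`-torsion translation `x((r, 0) + v)` -/

section TwoTorsionTranslation

variable {K : Type*} [Field K] {V : WeierstrassCurve K} [V.IsShortNF]

/-- **`x((r, 0) + v)` on a short Weierstrass curve**: for the `2`-torsion point `(r, 0)` and an
affine point `v = (x₂, y₂)` with `x₂ ≠ r`, `(x₂ - r)²·x((r,0) + v) = y₂² - (x₂ - r)²(r + x₂)`
(the chord through `(r, 0)` has slope `y₂/(x₂ - r)`): the Group Law Algorithm III.2.3 with
`y₁ = 0`, `a₁ = a₂ = a₃ = 0`. [cite: SilvermanAEC2009, III.2.3 (Group Law Algorithm, `x₃ = λ² + a₁λ - a₂ - x₁ - x₂`)] -/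
theorem sq_mul_xOf_twoTorsion_add {r x₂ y₂ : K} (hT : V.toAffine.Nonsingular r 0)
    (h₂ : V.toAffine.Nonsingular x₂ y₂) (hx : r ≠ x₂) :
    (x₂ - r) ^ 2 * xOf (some r 0 hT + some x₂ y₂ h₂) = y₂ ^ 2 - (x₂ - r) ^ 2 * (r + x₂) := by
  have hx' : r - x₂ ≠ 0 := sub_ne_zero.mpr hx
  rw [add_of_X_ne hx, xOf_some, Affine.addX, Affine.slope_of_X_ne hx, V.a₁_of_isShortNF,
    V.a₂_of_isShortNF]
  field_simp
  ring

/-- **The `2`-torsion translation on `y² = (x - r₁)(x - r₂)(x - r₃)`**: for `v = (x₂, y₂)` with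
`y₂² = (x₂ - r₁)(x₂ - r₂)(x₂ - r₃)`, `r₁ + r₂ + r₃ = 0` and `x₂ ≠ r₁`,
`(x₂ - r₁)·(x((r₁,0) + v) - r₂) = (r₁ - r₂)·(x₂ - r₃)` — i.e.
`x((r₁,0) + v) - r₂ = (r₁ - r₂)(x(v) - r₃)/(x(v) - r₁)` — the Group Law Algorithm at a
`2`-torsion point, as used for the `2`-descent maps `x - eᵢ` (AEC X.1).
[cite: SilvermanAEC2009, III.2.3 (Group Law Algorithm) with Prop. X.1.4 (the maps `x - eᵢ` at `eᵢ`-translates)] -/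
theorem sub_mul_xOf_twoTorsion_add_sub {r₁ r₂ r₃ x₂ y₂ : K} (hT : V.toAffine.Nonsingular r₁ 0)
    (h₂ : V.toAffine.Nonsingular x₂ y₂) (hx : r₁ ≠ x₂)
    (hy : y₂ ^ 2 = (x₂ - r₁) * (x₂ - r₂) * (x₂ - r₃)) (hsum : r₁ + r₂ + r₃ = 0) :
    (x₂ - r₁) * (xOf (some r₁ 0 hT + some x₂ y₂ h₂) - r₂) = (r₁ - r₂) * (x₂ - r₃) := by
  have hx' : x₂ - r₁ ≠ 0 := sub_ne_zero.mpr (Ne.symm hx)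
  have h := sq_mul_xOf_twoTorsion_add hT h₂ hx
  apply mul_left_cancel₀ hx'
  have hr₃ : r₃ = -r₁ - r₂ := by linear_combination hsum
  subst hr₃
  linear_combination h + hy

end TwoTorsionTranslation

/-! ### Products over `G ∖ O` against the kernel polynomial -/

section KernelProducts

variable {K : Type*} [Field K] {V : WeierstrassCurve K} {G : Finset V.toAffine.Point}

/-- **`Π_{v ∈ G ∖ O} (x(v) - c) = D(c)²`**: the points `±v` of `G ∖ O` share their `x`-coordinate,
and `D = Π_{c' ∈ x(G ∖ O)} (X - c')` (`P₂ = D²` evaluated at `c`: Kohel's kernel polynomial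
`ψ(x)` with `ψ² = Π_{Q ≠ O}(x - x(Q))`). [cite: Kohel1996, §2.4 (the kernel polynomial of an odd subgroup)] -/
theorem prod_erase_zero_xOf_sub (hG : IsOddSubgroupFinset G) (c : K) :
    ∏ v ∈ G.erase 0, (xOf v - c) = (veluD G).eval c ^ 2 := by
  rw [eval_veluD, ← Finset.prod_pow]
  exact prod_erase_zero_eq_prod_veluXVals hG (fun v => xOf v - c) (fun c' => (c - c') ^ 2)
    fun v _ => by rw [xOf_neg]; ring

end KernelProducts

/-! ### Over a field where `f` splits: the `2`-torsion points of `E'` and the discriminant -/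

section Split

variable {F : Type*} [Field F] {W : WeierstrassCurve F} [W.IsShortNF] [W.IsElliptic]

omit [W.IsShortNF] [W.IsElliptic] in
/-- **Vieta for `f = (X - r₁)(X - r₂)(X - r₃) = X³ + a₄X + a₆`**: `r₁ + r₂ + r₃ = 0`,
`r₁r₂ + r₁r₃ + r₂r₃ = a₄`, `r₁r₂r₃ = -a₆`. Private plumbing. [folklore] -/
private theorem roots_vieta_of_factorisation {r₁ r₂ r₃ : F}
    (hf : veluF (W⁄F) = (X - C r₁) * (X - C r₂) * (X - C r₃)) :
    r₁ + r₂ + r₃ = 0 ∧ r₁ * r₂ + r₁ * r₃ + r₂ * r₃ = W.a₄ ∧ r₁ * r₂ * r₃ = -W.a₆ := by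
  rw [X_sub_C_mul_three, veluF] at hf
  have h2 := congrArg (Polynomial.coeff · 2) hf
  have h1 := congrArg (Polynomial.coeff · 1) hf
  have h0 := congrArg (Polynomial.coeff · 0) hf
  simp only [coeff_add, coeff_sub, coeff_C_mul, coeff_X_pow, coeff_X, coeff_C] at h2 h1 h0
  norm_num at h2 h1 h0
  exact ⟨by linear_combination h2, by linear_combination -h1, by linear_combination h0⟩

omit [W.IsElliptic] in
/-- On `y² = (x - r₁)(x - r₂)(x - r₃)`: `y(v)² = (x(v) - r₁)(x(v) - r₂)(x(v) - r₃)` for an affine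
point `v = (x, y)`. Private plumbing. [folklore] -/
private theorem sq_eq_prod_sub_of_factorisation {r₁ r₂ r₃ : F}
    (hf : veluF (W⁄F) = (X - C r₁) * (X - C r₂) * (X - C r₃)) {x y : F}
    (h : (W⁄F).toAffine.Nonsingular x y) : y ^ 2 = (x - r₁) * (x - r₂) * (x - r₃) := by
  rw [yOf_sq_eq h, ← eval_veluF, hf]
  simp only [eval_mul, eval_sub, eval_X, eval_C]

/-- **The `2`-torsion points of the Vélu curve.** For `f = (X - r₁)(X - r₂)(X - r₃)` and the roots
`ρᵢ = ρ_{rᵢ} = U(rᵢ)/D(rᵢ)²` of the Vélu cubic (`veluCubic_eq_prod`):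
`D(r₁)²·D(r₂)²·(ρ₁ - ρ₂) = (r₁ - r₂)^{#G}·D(r₃)²`. Proof: the norm of `x - r₂` along `G` at the
`2`-torsion point `(r₁, 0)` is `V_{r₂}(r₁)/D(r₁)² = D(r₂)²(ρ₁ - ρ₂)` (`veluD_sq_mul_norm`,
`veluV_eq_of_isRoot`), and it equals `(r₁ - r₂)·Π_{v ≠ O}(r₁ - r₂)(x(v) - r₃)/(x(v) - r₁)` by the
`2`-torsion translation. This is the `2`-torsion part of the comparison of `Δ(E)` and `Δ(E')`
for Vélu's isogeny. [cite: Velu1971, (the quotient `E/F`, `y² = x³ + A₄'x + A₆'`: its points of order `2` are the images `(X(rᵢ,0), 0)`)] -/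
theorem veluRho_sub_veluRho [CharZero F] {G : Finset (W⁄F).toAffine.Point} (hG : IsOddSubgroupFinset G)
    {r₁ r₂ r₃ : F} (hf : veluF (W⁄F) = (X - C r₁) * (X - C r₂) * (X - C r₃)) :
    (veluD G).eval r₁ ^ 2 * (veluD G).eval r₂ ^ 2 * (veluRho G r₁ - veluRho G r₂) =
      (r₁ - r₂) ^ G.card * (veluD G).eval r₃ ^ 2 := by
  obtain ⟨hr₁, hr₂, -⟩ := isRoot_of_factorisation hf
  obtain ⟨hsum, -, -⟩ := roots_vieta_of_factorisation hf
  have hgood₁ := xOf_ne_of_isRoot hG hr₁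
  have hD₁ : (veluD G).eval r₁ ≠ 0 := eval_veluD_ne_zero hgood₁
  have hT₁ : (W⁄F).toAffine.Nonsingular r₁ 0 := nonsingular_of_isRoot hr₁
  -- the norm of `x - r₂` at `(r₁, 0)`
  have hnorm := veluD_sq_mul_norm hG hT₁ hgood₁ r₂
  rw [veluV_eq_of_isRoot hG hr₂] at hnorm
  simp only [eval_mul, eval_sub, eval_C, eval_pow] at hnorm
  have hU₁ : (veluU G).eval r₁ = veluRho G r₁ * (veluD G).eval r₁ ^ 2 := by
    rw [veluRho, div_mul_cancel₀ _ (pow_ne_zero 2 hD₁)]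
  rw [hU₁, ← Finset.mul_prod_erase _ _ hG.zero_mem, add_zero, xOf_some] at hnorm
  -- the product over `G ∖ O`, by the `2`-torsion translation
  have hprod : (∏ v ∈ G.erase 0, (xOf v - r₁)) *
      ∏ v ∈ G.erase 0, (xOf (Point.some r₁ 0 hT₁ + v) - r₂) =
        ∏ v ∈ G.erase 0, ((r₁ - r₂) * (xOf v - r₃)) := by
    rw [← Finset.prod_mul_distrib]
    refine Finset.prod_congr rfl fun v hv => ?_
    have hv0 : v ≠ 0 := (Finset.mem_erase.mp hv).1
    rcases v with _ | ⟨x₂, y₂, h₂⟩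
    · exact (hv0 rfl).elim
    have hx : r₁ ≠ x₂ := fun h => hgood₁ _ hv (by rw [xOf_some, h])
    rw [xOf_some]
    exact sub_mul_xOf_twoTorsion_add_sub hT₁ h₂ hx (sq_eq_prod_sub_of_factorisation hf h₂) hsum
  rw [Finset.prod_mul_distrib, Finset.prod_const, prod_erase_zero_xOf_sub hG r₁,
    prod_erase_zero_xOf_sub hG r₃] at hprod
  rw [← Finset.card_erase_add_one hG.zero_mem, pow_succ]
  linear_combination -hnorm + (r₁ - r₂) * hprod

omit [W.IsElliptic] in
/-- **`Π_{v ∈ G ∖ O} y(v)² = D(r₁)²·D(r₂)²·D(r₃)²`** on `y² = (x - r₁)(x - r₂)(x - r₃)`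
(`y(v)² = Πᵢ (x(v) - rᵢ)` and `Π_{v ≠ O}(x(v) - rᵢ) = D(rᵢ)²`: the resultant of `f` and Kohel's
kernel polynomial). [cite: Kohel1996, §2.4 (kernel polynomial `ψ`, `ψ² = Π_{Q ≠ O}(x - x(Q))`)] -/
theorem prod_erase_zero_yOf_sq {G : Finset (W⁄F).toAffine.Point} (hG : IsOddSubgroupFinset G)
    {r₁ r₂ r₃ : F} (hf : veluF (W⁄F) = (X - C r₁) * (X - C r₂) * (X - C r₃)) :
    ∏ v ∈ G.erase 0, yOf v ^ 2 =
      (veluD G).eval r₁ ^ 2 * (veluD G).eval r₂ ^ 2 * (veluD G).eval r₃ ^ 2 := by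
  rw [← prod_erase_zero_xOf_sub hG r₁, ← prod_erase_zero_xOf_sub hG r₂, ← prod_erase_zero_xOf_sub hG r₃,
    ← Finset.prod_mul_distrib, ← Finset.prod_mul_distrib]
  refine Finset.prod_congr rfl fun v hv => ?_
  have hv0 : v ≠ 0 := (Finset.mem_erase.mp hv).1
  rcases v with _ | ⟨x₂, y₂, h₂⟩
  · exact (hv0 rfl).elim
  rw [xOf_some, yOf_some]
  exact sq_eq_prod_sub_of_factorisation hf h₂

omit [W.IsShortNF] [W.IsElliptic] in
/-- `#G` is odd (`#(G ∖ O) = 2·#x(G ∖ O)`). Private plumbing. [folklore] -/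
private theorem odd_card_of_isOddSubgroupFinset {G : Finset (W⁄F).toAffine.Point} (hG : IsOddSubgroupFinset G) :
    G.card = 2 * (veluXVals G).card + 1 := by
  rw [← Finset.card_erase_add_one hG.zero_mem, card_erase_zero_eq hG]

/-- **The discriminant of the Vélu curve, split form**: for `f = (X - r₁)(X - r₂)(X - r₃)` over a
field of characteristic `0` and an odd subgroup `G`,
`(4a'³ + 27b'²)·Π_{v ∈ G ∖ O} y(v)⁴ = (4a₄³ + 27a₆²)^{#G}` (split form of
`veluDisc_mul_prod_yOf_pow_four`).
[cite: DokchitserDokchitser2015LocalInvariants, §2 Thm. 3 (Coates): the discriminant relation `Δ(E') ~ Δ(E)^p`, algebraic form via Vélu, split case] -/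
theorem veluDisc_mul_prod_yOf_pow_four_of_factorisation [CharZero F] {G : Finset (W⁄F).toAffine.Point}
    (hG : IsOddSubgroupFinset G) {r₁ r₂ r₃ : F}
    (hf : veluF (W⁄F) = (X - C r₁) * (X - C r₂) * (X - C r₃)) :
    (4 * veluA G ^ 3 + 27 * veluB G ^ 2) * ∏ v ∈ G.erase 0, yOf v ^ 4 =
      (4 * W.a₄ ^ 3 + 27 * W.a₆ ^ 2) ^ G.card := by
  obtain ⟨hr₁, hr₂, hr₃⟩ := isRoot_of_factorisation hf
  obtain ⟨hsum, ha₄, ha₆⟩ := roots_vieta_of_factorisation hf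
  obtain ⟨hρs, hρa, hρb⟩ := veluRho_vieta hG hf
  have hD₁ : (veluD G).eval r₁ ≠ 0 := eval_veluD_ne_zero (xOf_ne_of_isRoot hG hr₁)
  have hD₂ : (veluD G).eval r₂ ≠ 0 := eval_veluD_ne_zero (xOf_ne_of_isRoot hG hr₂)
  have hD₃ : (veluD G).eval r₃ ≠ 0 := eval_veluD_ne_zero (xOf_ne_of_isRoot hG hr₃)
  -- the three differences of the `ρ`'s
  have hf₁₃ : veluF (W⁄F) = (X - C r₁) * (X - C r₃) * (X - C r₂) := by rw [hf]; ring
  have hf₂₃ : veluF (W⁄F) = (X - C r₂) * (X - C r₃) * (X - C r₁) := by rw [hf]; ring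
  have h₁₂ := veluRho_sub_veluRho hG hf
  have h₁₃ := veluRho_sub_veluRho hG hf₁₃
  have h₂₃ := veluRho_sub_veluRho hG hf₂₃
  have hY := prod_erase_zero_yOf_sq hG hf
  set n := G.card with hn
  set d₁ := (veluD G).eval r₁
  set d₂ := (veluD G).eval r₂
  set d₃ := (veluD G).eval r₃
  set ρ₁ := veluRho G r₁
  set ρ₂ := veluRho G r₂
  set ρ₃ := veluRho G r₃
  have hd : d₁ ^ 2 * d₂ ^ 2 * d₃ ^ 2 ≠ 0 := by positivity
  -- `d₁²d₂²d₃²·Π(ρᵢ - ρⱼ) = Π(rᵢ - rⱼ)^n`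
  have H : (d₁ ^ 2 * d₂ ^ 2 * (ρ₁ - ρ₂)) * (d₁ ^ 2 * d₃ ^ 2 * (ρ₁ - ρ₃)) * (d₂ ^ 2 * d₃ ^ 2 * (ρ₂ - ρ₃)) =
      ((r₁ - r₂) ^ n * d₃ ^ 2) * ((r₁ - r₃) ^ n * d₂ ^ 2) * ((r₂ - r₃) ^ n * d₁ ^ 2) := by
    rw [h₁₂, h₁₃, h₂₃]
  have key : d₁ ^ 2 * d₂ ^ 2 * d₃ ^ 2 * ((ρ₁ - ρ₂) * (ρ₁ - ρ₃) * (ρ₂ - ρ₃)) =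
      ((r₁ - r₂) * (r₁ - r₃) * (r₂ - r₃)) ^ n := by
    apply mul_left_cancel₀ hd
    rw [mul_pow, mul_pow]
    linear_combination H
  have key₂ : (d₁ ^ 2 * d₂ ^ 2 * d₃ ^ 2) ^ 2 * ((ρ₁ - ρ₂) * (ρ₁ - ρ₃) * (ρ₂ - ρ₃)) ^ 2 =
      (((r₁ - r₂) * (r₁ - r₃) * (r₂ - r₃)) ^ 2) ^ n := by
    rw [← mul_pow, key, ← pow_mul, ← pow_mul, mul_comm 2 n]
  -- the products of `y(v)⁴`
  have hY₄ : ∏ v ∈ G.erase 0, yOf v ^ 4 = (d₁ ^ 2 * d₂ ^ 2 * d₃ ^ 2) ^ 2 := by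
    rw [← hY, ← Finset.prod_pow]
    exact Finset.prod_congr rfl fun v _ => by ring
  -- discriminants of the two depressed cubics
  have hρ₃ : ρ₃ = -ρ₁ - ρ₂ := by linear_combination hρs
  have hr₃ : r₃ = -r₁ - r₂ := by linear_combination hsum
  have hdisc' : 4 * veluA G ^ 3 + 27 * veluB G ^ 2 = -((ρ₁ - ρ₂) * (ρ₁ - ρ₃) * (ρ₂ - ρ₃)) ^ 2 := by
    rw [← hρa, show veluB G = -(ρ₁ * ρ₂ * ρ₃) by linear_combination hρb, hρ₃]; ring
  have hdisc : 4 * W.a₄ ^ 3 + 27 * W.a₆ ^ 2 = -((r₁ - r₂) * (r₁ - r₃) * (r₂ - r₃)) ^ 2 := by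
    rw [← ha₄, show W.a₆ = -(r₁ * r₂ * r₃) by linear_combination ha₆, hr₃]; ring
  have hodd : Odd n := ⟨(veluXVals G).card, odd_card_of_isOddSubgroupFinset hG⟩
  rw [hdisc', hY₄, hdisc, Odd.neg_pow hodd, ← key₂]
  ring

end Split

/-! ### Over any field of characteristic `0` -/

section Descent

variable {K : Type*} [Field K] [CharZero K] (W : WeierstrassCurve K) [W.IsShortNF] [W.IsElliptic]

omit [CharZero K] [W.IsShortNF] [W.IsElliptic] in
/-- The monic cubic `f = X³ + a₄X + a₆` factors over an algebraically closed extension.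
Private plumbing. [folklore] -/
private theorem exists_veluF_eq_prod (L : Type*) [Field L] [Algebra K L] [IsAlgClosed L] :
    ∃ r₁ r₂ r₃ : L, veluF (W⁄L) = (X - C r₁) * (X - C r₂) * (X - C r₃) := by
  have hlin : (C (W⁄L).a₄ * X + C (W⁄L).a₆).degree < ((3 : ℕ) : WithBot ℕ) :=
    degree_linear_le.trans_lt (by decide)
  have hmon : (veluF (W⁄L)).Monic := by
    rw [veluF, add_assoc]; exact monic_X_pow_add hlin
  have hnd : (veluF (W⁄L)).natDegree = 3 := by
    rw [veluF, add_assoc, natDegree_add_eq_left_of_degree_lt, natDegree_X_pow]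
    rw [degree_X_pow]; exact hlin
  have hspl : (veluF (W⁄L)).Splits := IsAlgClosed.splits _
  have hcard : (veluF (W⁄L)).roots.card = 3 := by rw [splits_iff_card_roots.mp hspl, hnd]
  obtain ⟨r₁, r₂, r₃, hroots⟩ := Multiset.card_eq_three.mp hcard
  refine ⟨r₁, r₂, r₃, ?_⟩
  conv_lhs => rw [hspl.eq_prod_roots_of_monic hmon, hroots]
  simp only [Multiset.insert_eq_cons, Multiset.map_cons, Multiset.map_singleton, Multiset.prod_cons,
    Multiset.prod_singleton]
  ring

/-- **The discriminant of Vélu's quotient by an odd subgroup**: for a short Weierstrass elliptic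
curve `E : y² = x³ + a₄x + a₆` over a field `K` of characteristic `0`, a finite subgroup
`G ⊆ E(K)` without points of order `2`, and Vélu's quotient `E/G : y² = x³ + a'x + b'`
(`a' = veluA G`, `b' = veluB G`):
`(4a'³ + 27b'²) · Π_{v ∈ G ∖ O} y(v)⁴ = (4a₄³ + 27a₆²)^{#G}`.
Equivalently `Δ(E/G)·Π_{v ≠ O}(2y(v))⁴ = Δ(E)^{#G}` (`veluDelta_mul_prod_pow_four`). This is the
discriminant relation behind Coates' lemma «`Δ(E)^p/Δ(E')` is a `12`-th power for a `p`-isogeny,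
`p > 3`» in its algebraic form for every odd kernel (Dokchitser–Dokchitser prove it through the
`η`-quotient `(η(pτ)^p/η(τ))²`). [Dokchitser–Dokchitser 2015, §2 Thm. 3 and Table 1 (discriminant
row); Coates 1991, appendix Thm. 8; Vélu 1971]
[cite: DokchitserDokchitser2015LocalInvariants, §2 Thm. 3 (Coates) — the discriminant relation Δ' ~ Δ^p, algebraic form via Vélu] -/
theorem veluDisc_mul_prod_yOf_pow_four {G : Finset (W⁄K).toAffine.Point} (hG : IsOddSubgroupFinset G) :
    (4 * veluA G ^ 3 + 27 * veluB G ^ 2) * ∏ v ∈ G.erase 0, yOf v ^ 4 =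
      (4 * W.a₄ ^ 3 + 27 * W.a₆ ^ 2) ^ G.card := by
  let L := AlgebraicClosure K
  -- the base change `W(K) → W(L)` on points (as in `VeluOddKernelProofs`)
  let mapL := Affine.Point.map (W' := W) (Algebra.ofId K L)
  obtain ⟨r₁, r₂, r₃, hf⟩ := exists_veluF_eq_prod W L
  -- the split identity for `W⁄L` and `G ⊗ L` (the curve `(W⁄L)⁄L` is `W⁄L` by `rfl`)
  have key : (4 * veluA (G.image mapL) ^ 3 + 27 * veluB (G.image mapL) ^ 2) *
      ∏ v ∈ (G.image mapL).erase 0, yOf v ^ 4 =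
        (4 * (W⁄L).a₄ ^ 3 + 27 * (W⁄L).a₆ ^ 2) ^ (G.image mapL).card :=
    veluDisc_mul_prod_yOf_pow_four_of_factorisation (W := W⁄L) (G := G.image mapL) (hG.image W) hf
  rw [veluA_image W, veluB_image W, image_erase_zero W,
    Finset.prod_image fun u _ v _ h => Affine.Point.map_injective _ h,
    Finset.card_image_of_injective _ (Affine.Point.map_injective _)] at key
  simp_rw [yOf_map W] at key
  have e4 : (W⁄L).a₄ = algebraMap K L W.a₄ := rfl
  have e6 : (W⁄L).a₆ = algebraMap K L W.a₆ := rfl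
  rw [e4, e6] at key
  apply (algebraMap K L).injective
  simp only [map_mul, map_add, map_pow, map_prod, map_ofNat]
  exact key

/-- **`Δ(E/G) · Π_{v ∈ G ∖ O} (2y(v))⁴ = Δ(E)^{#G}`** for Vélu's quotient
`E/G = ⟨0, 0, 0, a', b'⟩` of a short Weierstrass elliptic curve over a field of characteristic `0`
by a finite subgroup without `2`-torsion (`Δ = -16(4a³ + 27b²)` for both short models). Hence,
for a `K`-rational odd kernel, `Δ(E)^{#G} ≡ Δ(E/G)·N⁴` with `N = Π_{v ≠ O} 2y(v)`, modulo `12`-th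
powers for any other model of `E/G`. [Dokchitser–Dokchitser 2015, §2 Thm. 3 (Coates 1991,
appendix, Thm. 8); Vélu 1971]
[cite: DokchitserDokchitser2015LocalInvariants, §2 Thm. 3 (Coates): Δ^p/Δ' — discriminant relation, Vélu form] -/
theorem veluDelta_mul_prod_pow_four {G : Finset (W⁄K).toAffine.Point} (hG : IsOddSubgroupFinset G) :
    (⟨0, 0, 0, veluA G, veluB G⟩ : WeierstrassCurve K).Δ * ∏ v ∈ G.erase 0, (2 * yOf v) ^ 4 =
      W.Δ ^ G.card := by
  have h := veluDisc_mul_prod_yOf_pow_four W hG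
  have hΔ' : (⟨0, 0, 0, veluA G, veluB G⟩ : WeierstrassCurve K).Δ =
      -16 * (4 * veluA G ^ 3 + 27 * veluB G ^ 2) := by
    simp only [Δ, b₂, b₄, b₆, b₈]; ring
  have hprod : ∏ v ∈ G.erase 0, (2 * yOf v) ^ 4 = 16 ^ (G.erase 0).card * ∏ v ∈ G.erase 0, yOf v ^ 4 := by
    rw [← Finset.prod_const, ← Finset.prod_mul_distrib]
    exact Finset.prod_congr rfl fun v _ => by ring
  have hcard : G.card = (G.erase 0).card + 1 := (Finset.card_erase_add_one hG.zero_mem).symm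
  have hodd : Odd G.card := ⟨(veluXVals G).card, by rw [hcard, card_erase_zero_eq hG]⟩
  set D := 4 * W.a₄ ^ 3 + 27 * W.a₆ ^ 2 with hD
  rw [hΔ', hprod, W.Δ_of_isShortNF, ← hD, show -16 * D = -(16 * D) by ring, Odd.neg_pow hodd, mul_pow,
    hcard, pow_succ]
  rw [hcard] at h
  linear_combination (-16) * 16 ^ (G.erase 0).card * h

end Descent

end WeierstrassCurve
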